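import Literature.NumberTheory.Sieve.FordMaynardSliceBlocks
import Literature.Combinatorics.Enumerative.SetFunctionConvolutionRelabel
import Mathlib.MeasureTheory.Constructions.BorelSpace.Basic
import HarnessLib

/-!
# Ford–Maynard, Theorem 6.4: symmetrisation tools

Everything here is PROVED. First of the files proving Theorem 6.4 of K. Ford, J. Maynard,
*On the theory of prime producing sieves* (arXiv:2407.14368), the equivalence of (TypeI-f) and the
fragmentation relation (`Literature/NumberTheory/Sieve/FordMaynardFragmentation.lean`,
`FordMaynardFragmentation`). This file collects the measure-free and the "symmetrisation" tools:

* measurability: convex polytopes are measurable sets, piecewise-Lipschitz functions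
  (Definition 6.2 (b)) are measurable (`IsPiecewiseLipschitz.measurable`); the set functions
  `x ↦ N_{x,c}^{⋆j}(A)`, `x ↦ 𝓛_c(x_A)` are measurable in `x`, with crude uniform bounds
  (`abs_spow_le`, `abs_linnikFn_le`);
* naturality of the disjoint-union convolution under relabelling (`sconv_comp_map`);
* symmetric functions of vectors absorb any re-indexing equivalence
  (`VecFn.IsSymmetric.apply_comp_equiv`), appending commutes with permutations up to
  re-indexing (`append_comp_perm_right`, `append_eq_append_swap_comp`);
* finite additivity of slice integrals (`sliceIntegral_finset_sum`);
* **two-block symmetrisation** (`sliceIntegral_symm_sconv`): for `F` symmetric on `ℝ^n` and two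
  permutation-equivariant families of set functions `P_u, Q_u` (`u ∈ ℝ^n`),
  `∫_{Δ_n(w)} F(u) (P_u ⋆ Q_u)([n]) du = ∑_a C(n,a) ∫_{Δ_n(w)} F(u) P_u({i < a}) Q_u({i ≥ a}) du`,
  the step "since the integrand is symmetric, each of the `C(k, d)` decompositions contributes
  the same" of §6.1 (arXiv:2407.14368, proof of Theorem 6.4), here for two blocks; the slice
  measure is permutation invariant (`sliceIntegral_comp_perm`).

## References

* K. Ford, J. Maynard, *On the theory of prime producing sieves*, arXiv:2407.14368 (2024), §6.1.
  [FordMaynard2024PrimeSieves]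
-/

noncomputable section

open MeasureTheory Finset Literature.Combinatorics.Enumerative

namespace Literature.NumberTheory.Sieve.FordMaynard

/-! ### Measurability of polytopes and piecewise Lipschitz functions -/

/-- A convex polytope (Definition 5.7) is a measurable set. [folklore] -/
theorem IsConvexPolytope.measurableSet {k : ℕ} {P : Set (Fin k → ℝ)} (hP : IsConvexPolytope P) :
    MeasurableSet P := by
  obtain ⟨-, S, T, rfl⟩ := hP
  have hlin : ∀ c : (Fin k → ℝ) × ℝ, Measurable fun x : Fin k → ℝ => ∑ i, c.1 i * x i := fun c =>
    Finset.measurable_sum _ fun i _ => (measurable_pi_apply i).const_mul _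
  have h1 : MeasurableSet {x : Fin k → ℝ | ∀ c ∈ S, ∑ i, c.1 i * x i < c.2} := by
    have : {x : Fin k → ℝ | ∀ c ∈ S, ∑ i, c.1 i * x i < c.2} =
        ⋂ c ∈ S, {x | ∑ i, c.1 i * x i < c.2} := by
      ext x; simp
    rw [this]
    exact S.measurableSet_biInter fun c _ => measurableSet_lt (hlin c) measurable_const
  have h2 : MeasurableSet {x : Fin k → ℝ | ∀ c ∈ T, ∑ i, c.1 i * x i ≤ c.2} := by
    have : {x : Fin k → ℝ | ∀ c ∈ T, ∑ i, c.1 i * x i ≤ c.2} =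
        ⋂ c ∈ T, {x | ∑ i, c.1 i * x i ≤ c.2} := by
      ext x; simp
    rw [this]
    exact T.measurableSet_biInter fun c _ => measurableSet_le (hlin c) measurable_const
  have : {x : Fin k → ℝ | (∀ c ∈ S, ∑ i, c.1 i * x i < c.2) ∧ ∀ c ∈ T, ∑ i, c.1 i * x i ≤ c.2} =
      {x | ∀ c ∈ S, ∑ i, c.1 i * x i < c.2} ∩ {x | ∀ c ∈ T, ∑ i, c.1 i * x i ≤ c.2} := by
    ext x; simp
  rw [this]
  exact h1.inter h2

/-- A piecewise-Lipschitz function in the sense of Definition 6.2 (b) is (Borel) measurable: each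
piece is continuous on its polytope and vanishes outside. [folklore] -/
theorem IsPiecewiseLipschitz.measurable {k : ℕ} {g : (Fin k → ℝ) → ℝ} (hg : IsPiecewiseLipschitz g) :
    Measurable g := by
  classical
  obtain ⟨m, P, h, hP, hsum⟩ := hg
  rw [show g = fun x => ∑ j, h j x from funext hsum]
  refine Finset.measurable_sum _ fun j _ => ?_
  obtain ⟨hPj, h0, K, hK⟩ := hP j
  have hpw : h j = (P j).piecewise (h j) (fun _ => 0) := by
    funext x
    by_cases hx : x ∈ P j
    · rw [Set.piecewise_eq_of_mem _ _ _ hx]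
    · rw [Set.piecewise_eq_of_notMem _ _ _ hx, h0 x hx]
  rw [hpw]
  exact ContinuousOn.measurable_piecewise hK.continuousOn continuousOn_const hPj.measurableSet

/-! ### The set functions `N_{x,c}`, `𝓛_c(x_·)`: measurability in `x` and crude bounds -/

section SetFn

variable {α : Type*}

/-- `x ↦ N_{x,c}(B)` is measurable. [folklore] -/
theorem measurable_smallFn (c : ℝ) (B : Finset α) : Measurable fun x : α → ℝ => smallFn c x B := by
  unfold smallFn
  refine Measurable.ite ?_ measurable_const measurable_const
  by_cases hB : B.Nonempty
  · simp only [hB, true_and]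
    exact measurableSet_lt (Finset.measurable_sum _ fun i _ => measurable_pi_apply i) measurable_const
  · simp only [hB, false_and, Set.setOf_false, MeasurableSet.empty]

/-- `|N_{x,c}(B)| ≤ 1`. [folklore] -/
theorem abs_smallFn_le (c : ℝ) (x : α → ℝ) (B : Finset α) : |smallFn c x B| ≤ 1 := by
  unfold smallFn; split_ifs <;> simp

/-- `|(−1)^{j+1}/j| ≤ 1`. [folklore] -/
theorem abs_wLinnik_le (j : ℕ) : |wLinnik j| ≤ 1 := by
  unfold wLinnik
  rw [abs_div, abs_pow, abs_neg, abs_one, one_pow, Nat.abs_cast]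
  rcases Nat.eq_zero_or_pos j with rfl | hj
  · simp
  · rw [div_le_one (by exact_mod_cast hj)]
    exact_mod_cast hj

variable [DecidableEq α]

/-- Convolutions of families of set functions measurable in a parameter are measurable. [folklore] -/
theorem measurable_sconv {X : Type*} [MeasurableSpace X] {F G : X → Finset α → ℝ}
    (hF : ∀ B, Measurable fun x => F x B) (hG : ∀ B, Measurable fun x => G x B) (A : Finset α) :
    Measurable fun x => sconv (F x) (G x) A := by
  unfold sconv
  exact Finset.measurable_sum _ fun B _ => (hF B).mul (hG _)

/-- Convolution powers of a family of set functions measurable in a parameter are measurable.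
[folklore] -/
theorem measurable_spow {X : Type*} [MeasurableSpace X] {F : X → Finset α → ℝ}
    (hF : ∀ B, Measurable fun x => F x B) :
    ∀ (j : ℕ) (A : Finset α), Measurable fun x => spow (F x) j A
  | 0, A => by simp only [spow_zero]; exact measurable_const
  | j + 1, A => by
    simp only [spow_succ]
    exact measurable_sconv hF (measurable_spow hF j) A

/-- `x ↦ 𝓛_c(x_A)` is measurable. [folklore] -/
theorem measurable_linnikFn [Fintype α] (c : ℝ) (A : Finset α) : Measurable fun x : α → ℝ => linnikFn c x A := by
  unfold linnikFn
  exact Finset.measurable_sum _ fun j _ => (measurable_spow (measurable_smallFn c) j A).const_mul _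

/-- `|(F ⋆ G)(A)| ≤ 2^{|A|} a b` if `|F| ≤ a`, `|G| ≤ b`. [folklore] -/
theorem abs_sconv_le {F G : Finset α → ℝ} {a b : ℝ} (hF : ∀ B, |F B| ≤ a) (hG : ∀ B, |G B| ≤ b)
    (A : Finset α) : |sconv F G A| ≤ 2 ^ A.card * (a * b) := by
  unfold sconv
  refine (Finset.abs_sum_le_sum_abs _ _).trans ?_
  have : ∀ B ∈ A.powerset, |F B * G (A \ B)| ≤ a * b := fun B _ => by
    rw [abs_mul]
    exact mul_le_mul (hF B) (hG _) (abs_nonneg _) ((abs_nonneg _).trans (hF B))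
  refine (Finset.sum_le_sum this).trans ?_
  rw [Finset.sum_const, Finset.card_powerset, nsmul_eq_mul]
  push_cast
  exact le_rfl

/-- `|F^{⋆j}(B)| ≤ (2^{|α|} a)^j` if `|F| ≤ a`, `a ≥ 0`. [folklore] -/
theorem abs_spow_le [Fintype α] {F : Finset α → ℝ} {a : ℝ} (ha : 0 ≤ a) (hF : ∀ B, |F B| ≤ a) :
    ∀ (j : ℕ) (B : Finset α), |spow F j B| ≤ (2 ^ Fintype.card α * a) ^ j
  | 0, B => by
    simp only [spow_zero, sdelta, pow_zero]
    split_ifs <;> simp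
  | j + 1, B => by
    rw [spow_succ]
    refine (abs_sconv_le hF (abs_spow_le ha hF j) B).trans ?_
    have h2 : (2 : ℝ) ^ B.card ≤ 2 ^ Fintype.card α :=
      pow_le_pow_right₀ (by norm_num) (Finset.card_le_univ B)
    have hX : 0 ≤ (2 : ℝ) ^ Fintype.card α * a := by positivity
    calc (2 : ℝ) ^ B.card * (a * (2 ^ Fintype.card α * a) ^ j)
        ≤ 2 ^ Fintype.card α * (a * (2 ^ Fintype.card α * a) ^ j) :=
          mul_le_mul_of_nonneg_right h2 (by positivity)
      _ = (2 ^ Fintype.card α * a) ^ (j + 1) := by ring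

/-- A crude uniform bound for the Linnik function: `|𝓛_c(x_A)| ≤ n (2^n)^n`, `n = |α|`. [folklore] -/
theorem abs_linnikFn_le [Fintype α] (c : ℝ) (x : α → ℝ) (A : Finset α) :
    |linnikFn c x A| ≤ Fintype.card α * (2 ^ Fintype.card α) ^ Fintype.card α := by
  unfold linnikFn
  refine (Finset.abs_sum_le_sum_abs _ _).trans ?_
  have hterm : ∀ j ∈ Finset.Icc 1 (Fintype.card α),
      |wLinnik j * spow (smallFn c x) j A| ≤ ((2 : ℝ) ^ Fintype.card α) ^ Fintype.card α := by
    intro j hj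
    rw [abs_mul]
    have h1 := abs_wLinnik_le j
    have h2 := abs_spow_le (F := smallFn c x) zero_le_one (abs_smallFn_le c x) j A
    rw [mul_one] at h2
    have h3 : ((2 : ℝ) ^ Fintype.card α) ^ j ≤ (2 ^ Fintype.card α) ^ Fintype.card α :=
      pow_le_pow_right₀ (one_le_pow₀ (by norm_num)) (Finset.mem_Icc.1 hj).2
    calc |wLinnik j| * |spow (smallFn c x) j A| ≤ 1 * ((2 : ℝ) ^ Fintype.card α) ^ j :=
          mul_le_mul h1 h2 (abs_nonneg _) zero_le_one
      _ ≤ (2 ^ Fintype.card α) ^ Fintype.card α := by rw [one_mul]; exact h3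
  refine (Finset.sum_le_sum hterm).trans ?_
  rw [Finset.sum_const, Nat.card_Icc, nsmul_eq_mul]
  simp

/-! ### Naturality of the convolution under relabelling -/

/-- Pulling two set functions back along an embedding commutes with their convolution:
`((F ∘ map ι) ⋆ (G ∘ map ι))(S) = (F ⋆ G)(ι S)`. [folklore] -/
theorem sconv_comp_map {α' : Type*} [DecidableEq α'] (ι : α ↪ α') (F G : Finset α' → ℝ)
    (S : Finset α) :
    sconv (fun B => F (B.map ι)) (fun B => G (B.map ι)) S = sconv F G (S.map ι) := by
  unfold sconv
  refine Finset.sum_nbij' (fun B => B.map ι) (fun C => S.filter fun a => ι a ∈ C) ?_ ?_ ?_ ?_ ?_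
  · intro B hB
    rw [Finset.mem_powerset] at hB ⊢
    exact map_subset_map.2 hB
  · intro C _
    rw [Finset.mem_powerset]
    exact filter_subset _ _
  · intro B hB
    rw [Finset.mem_powerset] at hB
    ext a
    simp only [mem_filter, mem_map']
    exact ⟨fun h => h.2, fun h => ⟨hB h, h⟩⟩
  · intro C hC
    rw [Finset.mem_powerset] at hC
    ext y
    simp only [mem_map, mem_filter]
    constructor
    · rintro ⟨a, ⟨_, ha⟩, rfl⟩; exact ha
    · intro hy
      obtain ⟨a, haS, rfl⟩ := mem_map.1 (hC hy)
      exact ⟨a, ⟨haS, hy⟩, rfl⟩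
  · intro B _
    simp only [Finset.map_sdiff]

omit [DecidableEq α] in
/-- `N_{x∘σ,c}(B) = N_{x,c}(σ B)` for a permutation `σ`. [folklore] -/
theorem smallFn_comp_perm (σ : Equiv.Perm α) (c : ℝ) (x : α → ℝ) (B : Finset α) :
    smallFn c (x ∘ σ) B = smallFn c x (B.map σ.toEmbedding) :=
  smallFn_map σ.toEmbedding c x B

end SetFn

/-! ### Symmetric functions on vectors and re-indexing -/

/-- A symmetric function on vectors absorbs every re-indexing equivalence `Fin k ≃ Fin k'`
(necessarily `k = k'`). [folklore] -/
theorem VecFn.IsSymmetric.apply_comp_equiv {f : VecFn} (hf : f.IsSymmetric) {k k' : ℕ}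
    (e : Fin k ≃ Fin k') (v : Fin k' → ℝ) : f k (v ∘ e) = f k' v := by
  obtain rfl : k = k' := Fin.equiv_iff_eq.1 ⟨e⟩
  exact hf k e v

/-- Permuting the second block of `Fin.append y u` is a permutation of the whole vector.
[folklore] -/
theorem append_comp_perm_right {r d : ℕ} (y : Fin r → ℝ) (u : Fin d → ℝ) (σ : Equiv.Perm (Fin d)) :
    Fin.append y (u ∘ σ) = Fin.append y u ∘
      (finSumFinEquiv.symm.trans ((Equiv.sumCongr (Equiv.refl (Fin r)) σ).trans finSumFinEquiv)) := by
  funext x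
  refine Fin.addCases (fun j => ?_) (fun i => ?_) x
  · simp
  · simp

/-- Permuting the first block of `Fin.append y u` is a permutation of the whole vector.
[folklore] -/
theorem append_comp_perm_left {r d : ℕ} (y : Fin r → ℝ) (u : Fin d → ℝ) (σ : Equiv.Perm (Fin r)) :
    Fin.append (y ∘ σ) u = Fin.append y u ∘
      (finSumFinEquiv.symm.trans ((Equiv.sumCongr σ (Equiv.refl (Fin d))).trans finSumFinEquiv)) := by
  funext x
  refine Fin.addCases (fun j => ?_) (fun i => ?_) x
  · simp
  · simp

/-- Swapping the two blocks of `Fin.append` is a re-indexing equivalence. [folklore] -/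
theorem append_eq_append_swap_comp {r d : ℕ} (y : Fin r → ℝ) (u : Fin d → ℝ) :
    Fin.append y u = Fin.append u y ∘
      (finSumFinEquiv.symm.trans ((Equiv.sumComm (Fin r) (Fin d)).trans finSumFinEquiv)) := by
  funext x
  refine Fin.addCases (fun j => ?_) (fun i => ?_) x
  · simp
  · simp

/-- For `f ∈ 𝒮`: `f(y, u ∘ σ) = f(y, u)`. [cite: FordMaynard2024PrimeSieves, Definition 6.1] -/
theorem VecFn.IsSymmetric.append_perm_right {f : VecFn} (hf : f.IsSymmetric) {r d : ℕ}
    (y : Fin r → ℝ) (u : Fin d → ℝ) (σ : Equiv.Perm (Fin d)) :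
    f (r + d) (Fin.append y (u ∘ σ)) = f (r + d) (Fin.append y u) := by
  rw [append_comp_perm_right]
  exact hf _ _ _

/-- For `f ∈ 𝒮`: `f(y ∘ σ, u) = f(y, u)`. [cite: FordMaynard2024PrimeSieves, Definition 6.1] -/
theorem VecFn.IsSymmetric.append_perm_left {f : VecFn} (hf : f.IsSymmetric) {r d : ℕ}
    (y : Fin r → ℝ) (u : Fin d → ℝ) (σ : Equiv.Perm (Fin r)) :
    f (r + d) (Fin.append (y ∘ σ) u) = f (r + d) (Fin.append y u) := by
  rw [append_comp_perm_left]
  exact hf _ _ _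

/-- For `f ∈ 𝒮`: `f(y, u) = f(u, y)`. [cite: FordMaynard2024PrimeSieves, Definition 6.1] -/
theorem VecFn.IsSymmetric.append_swap {f : VecFn} (hf : f.IsSymmetric) {r d : ℕ}
    (y : Fin r → ℝ) (u : Fin d → ℝ) :
    f (r + d) (Fin.append y u) = f (d + r) (Fin.append u y) := by
  rw [append_eq_append_swap_comp y u]
  exact hf.apply_comp_equiv _ _

/-! ### Finite additivity of slice integrals -/

/-- Slice integrals commute with finite sums (bounded measurable integrands). [folklore] -/
theorem sliceIntegral_finset_sum {ι : Type*} (T : Finset ι) (d : ℕ) (w : ℝ)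
    (G : ι → (Fin d → ℝ) → ℝ) (hm : ∀ i, Measurable (G i)) {C : ℝ} (hb : ∀ i v, |G i v| ≤ C) :
    sliceIntegral d w (fun v => ∑ i ∈ T, G i v) = ∑ i ∈ T, sliceIntegral d w (G i) := by
  classical
  induction T using Finset.induction_on with
  | empty => simp [sliceIntegral_zero]
  | insert a T ha ih =>
    simp_rw [Finset.sum_insert ha]
    rw [← ih]
    refine sliceIntegral_add' d w (hm a) (Finset.measurable_sum _ fun i _ => hm i)
      (C := max C 0 * (T.card + 1)) (fun v => ?_) (fun v => ?_)
    · refine (hb a v).trans ?_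
      have : (0 : ℝ) ≤ T.card := by positivity
      nlinarith [le_max_left C 0, le_max_right C 0]
    · refine (Finset.abs_sum_le_sum_abs _ _).trans ?_
      refine (Finset.sum_le_sum fun i _ => (hb i v).trans (le_max_left C 0)).trans ?_
      rw [Finset.sum_const, nsmul_eq_mul]
      nlinarith [le_max_right C 0]

/-! ### Two-block symmetrisation -/

/-- For a permutation `σ`, `σ(A ∖ B) = σ A ∖ σ B` and `σ [n] = [n]`. [folklore] -/
theorem map_univ_sdiff_perm {β : Type*} [Fintype β] [DecidableEq β] (σ : Equiv.Perm β)
    (I : Finset β) : (Finset.univ \ I).map σ.toEmbedding = Finset.univ \ I.map σ.toEmbedding := by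
  rw [Finset.map_sdiff, Finset.map_univ_equiv]

/-- **Two-block symmetrisation.** Let `F : ℝ^n → ℝ` be symmetric and `P_u, Q_u` (`u ∈ ℝ^n`) two
families of set functions on `[n]`, equivariant under permutations (`P_{u∘σ}(S) = P_u(σ S)`), with
`F · P(S) · Q(S')` bounded measurable. Then
`∫_{Δ_n(w)} F(u) (P_u ⋆ Q_u)([n]) du = ∑_{a=0}^{n} C(n,a) ∫_{Δ_n(w)} F(u) P_u(I_a) Q_u([n] ∖ I_a) du`,
`I_a = {i : i < a}`: each of the `C(n, a)` subsets of size `a` contributes the same, by the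
permutation invariance of the slice measure. This is the symmetrisation step of §6.1 (proof of
Theorem 6.4), in its two-block form. [cite: FordMaynard2024PrimeSieves, §6.1 (proof of Theorem 6.4)] -/
theorem sliceIntegral_symm_sconv {n : ℕ} (w : ℝ) {F : (Fin n → ℝ) → ℝ}
    (hF : ∀ (σ : Equiv.Perm (Fin n)) (u : Fin n → ℝ), F (u ∘ σ) = F u)
    {P Q : (Fin n → ℝ) → Finset (Fin n) → ℝ}
    (hP : ∀ (σ : Equiv.Perm (Fin n)) (u : Fin n → ℝ) (S : Finset (Fin n)),
      P (u ∘ σ) S = P u (S.map σ.toEmbedding))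
    (hQ : ∀ (σ : Equiv.Perm (Fin n)) (u : Fin n → ℝ) (S : Finset (Fin n)),
      Q (u ∘ σ) S = Q u (S.map σ.toEmbedding))
    (hm : ∀ S S', Measurable fun u => F u * (P u S * Q u S')) {K : ℝ}
    (hK : ∀ S S' u, |F u * (P u S * Q u S')| ≤ K) :
    sliceIntegral n w (fun u => F u * sconv (P u) (Q u) Finset.univ) =
      ∑ a ∈ Finset.range (n + 1), (n.choose a : ℝ) *
        sliceIntegral n w (fun u => F u *
          (P u (univ.filter fun i : Fin n => (i : ℕ) < a) *
            Q u (univ \ univ.filter fun i : Fin n => (i : ℕ) < a))) := by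
  classical
  -- expand the convolution and integrate term by term
  have hexp : (fun u => F u * sconv (P u) (Q u) Finset.univ) =
      fun u => ∑ B ∈ (Finset.univ : Finset (Fin n)).powerset, F u * (P u B * Q u (univ \ B)) := by
    funext u
    unfold sconv
    rw [Finset.mul_sum]
  rw [hexp, sliceIntegral_finset_sum _ n w (fun B u => F u * (P u B * Q u (univ \ B)))
    (fun B => hm B _) (fun B u => hK B _ u)]
  -- group the subsets by cardinality
  rw [Finset.powerset_card_disjiUnion, Finset.sum_disjiUnion, Finset.card_univ, Fintype.card_fin]
  refine Finset.sum_congr rfl fun a ha => ?_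
  have han : a ≤ n := Nat.lt_succ_iff.1 (Finset.mem_range.1 ha)
  set I : Finset (Fin n) := univ.filter fun i : Fin n => (i : ℕ) < a with hI
  have hIcard : I.card = a := by rw [hI, Fin.card_filter_val_lt, min_eq_right han]
  -- every subset of size `a` contributes the same as `I`
  have hsame : ∀ B ∈ Finset.powersetCard a (Finset.univ : Finset (Fin n)),
      sliceIntegral n w (fun u => F u * (P u B * Q u (univ \ B))) =
        sliceIntegral n w (fun u => F u * (P u I * Q u (univ \ I))) := by
    intro B hB
    have hBcard : B.card = a := (Finset.mem_powersetCard.1 hB).2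
    obtain ⟨σ, hσ⟩ := Equiv.Perm.exists_map_finset_eq I B (hIcard.trans hBcard.symm)
    rw [← hσ, ← map_univ_sdiff_perm σ I]
    have : (fun u => F u * (P u (I.map σ.toEmbedding) * Q u ((univ \ I).map σ.toEmbedding))) =
        fun u => (fun v => F v * (P v I * Q v (univ \ I))) (u ∘ σ) := by
      funext u
      simp only [hF σ u, hP σ u, hQ σ u]
    rw [this]
    exact sliceIntegral_comp_perm w σ (fun v => F v * (P v I * Q v (univ \ I)))
  rw [Finset.sum_congr rfl hsame, Finset.sum_const, Finset.card_powersetCard, Finset.card_univ,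
    Fintype.card_fin, nsmul_eq_mul]

end Literature.NumberTheory.Sieve.FordMaynard
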